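/-
Copyright: public-domain mathematics; typed transcription for the H21 Literature library (cell lit-balaban,
Phase-2 proof seat p38 gen 6 = literature-prover-lit-balaban-p38-g6-0; design memo (d) of the B5 fold owner r02).

statement-level skeleton of published theorems with citation tags; proofs where landed; nothing here is a claim about the Yang–Mills mass gap

# Bałaban, *Propagators and renormalization transformations for lattice gauge theories. I*,
# Commun. Math. Phys. **95** (1984) 17–40 — PROPOSITION 1.2 FOR THE OPERATOR G = Δ_a⁻¹ OF RECORD ON BAŁABAN'S TORI, from
# Proposition 1.2 for G₀ (a theorem), (1.126) for the matrix of record `∂·P·∂*`, and (1.114) for G — the (1.132) ASSEMBLY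

[cite: Balaban1984PropagatorsI]  T. Bałaban, Commun. Math. Phys. 95 (1984) 17–40.  p. 39 [PDF 23], verbatim: «This proof, and
also a proof of (1.115)–(1.117), makes use of the identity G = G₀ + G₀∂P∂*G, (1.132) where G₀ = (Δ + aQ*Q)^{−1}. … We will
prove (1.115)–(1.117), and in fact the whole Proposition 1.2, for the operator G₀. This together with the properties (1.126),
(1.127) of ∂P∂* and (1.89), or (1.114) for the operator G implies immediately (1.115)–(1.117), or Proposition 1.2 for G.»;
p. 38 [PDF 22]: «|(∂P∂*)_{μ,ν}(x, x′)| ≦ O(1)e^{−δ′₀|x−x′|}, (1.126) … The constant O(1) in (1.126) depends on d only»;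
pp. 35–36 [PDF 19–20]: Proposition 1.2 (1.108)–(1.114); p. 36: «(1.110)–(1.114) imply immediately (1.115)–(1.117)».

WHAT THIS MODULE PROVES (SKELETON row B5.Prop1.2, owner's census (vii)-(1.132), r02 DESIGN-MEMO step (d), third file; rows
B5.Eq1.115–1.117 for G as a corollary).  Families over B5's top-level tori `i : B5ResidualGpTorusHolds.TopIdx d L` (`i.P.d = d`,
`i.P.L = L`, `K ≥ 1`): `famG d L a i := B5SettingP12Real.latticeSettingP12R (nP i.P) (MP i.P) a i.P.K` (r02's REAL SETTING OF
RECORD, G = Δ_a⁻¹ = (DeltaA)⁻¹), its h1-truncated copy `famGt` (`B5Carrier132Pieces.latticeSettingP12Rt`), and p37's diagonal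
G₀-family `B5G0DiagTorus.famDiagTop d L a 0` (Prop. 1.2 PROVED: p38 g5 `B5Local114G0Torus.prop12Printed_famDiagTop`).
* §1 `kerBound_kd_of_entries`: (1.126) ENTRYWISE for the matrix of record `V = ∂·PcT·∂ᴴ` (`‖V_{(x,μ),(x′,ν)}‖ ≤ C·η^d·e^{−δ|x−x′|}`,
  the shape of p16's `B5PBridgeKernel126.norm_GradOp_PcT_GradOp_adjoint_le`) ⇒ r02's `B5Transfer132.KerBound (kd P) (d²C) δ` for the
  kernel data of record (`η^{−d}`-weighted, indices summed); `kerBound_fam_of_entries`: the family form over `TopIdx d L`.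
* §2 the families, `local114_famGt_of` / `prop12_famG_of_famGt` (the truncation is invisible to (1.114) and to Prop. 1.2), and the
  located leaves of r02/b05's `B5Transfer132` for EVERY member with FAMILY-UNIFORM constants: `MapFacts` (r0 = 6, Nn = 13^d),
  `PieceFacts132` (A = √d, B = √(d³3^d), c₀ = 2), `Display133` (Dh = d + 1), `URow` (Λ(κ) = K_d(κ)), the model signs.
* §3 **`prop12_famG`**: `B5.Prop12Printed (famG d L a)` (every d ≥ 1, odd L > 1, a > 0) from
  (H126) `∃ δ′₀ C, 0 < δ′₀ ∧ 0 < C ∧ ∀ i, KerBound (kd i.P) C δ′₀` and (H114) `B5.Local114Fam (famG d L a)` — r02's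
  `B5Transfer132KerBound.prop12_of_G0_via132_of_kerBound` with every located leaf discharged and Prop. 1.2 for G₀ a theorem;
  **`kerBound_fam`**: (H126) DISCHARGED by p16's `B5PBridgeKernel126.norm_GradOp_PcT_GradOp_adjoint_le` ((1.126) for r02's
  typed `∂·PcT·∂ᴴ` from b05's `B5DPD126Uniform`, constants depending on d only); hence **`prop12_famG_of_local114`**:
  `B5.Local114Fam (famG d L a) → B5.Prop12Printed (famG d L a)` — PROPOSITION 1.2 FOR G ON THE TORUS MODULO (1.114) FOR G ONLY;
* §4 **`global115_117_famG`**: (1.115)–(1.117) for G (`B5.Global115_117Fam`) from `B5.Prop12Printed (famG d L a)` by r02's cover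
  of record (`B5SettingP12Real.globCoverP12R`, `B5Global115.global_of_prop12`); `global115_117_famG_of_local114` — rows
  B5.Eq1.115–1.117 for G modulo (1.114) for G.
REMAINING PRINTED INPUT of Proposition 1.2 (and of (1.115)–(1.117)) for G on the torus after this module: (1.114) for G =
`B5.Local114Fam (famG d L a)` (p37 g7, Combes–Thomas in L², files `B5CombesThomasLattice…` / `B5Local114GLattice`; the paper's
own road is the L² random-walk expansion of Sect. E, p. 39 «the proof of inequalities (1.114) … is completed because we have proved
inequalities (1.89)»).

HONEST SCOPE.  Assembly and bookkeeping only (uniform constants across tori of one dimension via `i.hPd`); U = 1; constants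
explicit, not optimised.  Value = the printed word «immediately» (p. 39) kernel-checked for Bałaban's own G — NOT summit progress.
-/
import Mathlib
import Literature.MathematicalPhysics.QuantumFieldTheory.Balaban1983to89.B5Display132Lattice
import Literature.MathematicalPhysics.QuantumFieldTheory.Balaban1983to89.B5Transfer132KerBound
import Literature.MathematicalPhysics.QuantumFieldTheory.Balaban1983to89.B5Local114G0Torus
import Literature.MathematicalPhysics.QuantumFieldTheory.Balaban1983to89.B5PBridgeKernel126

open scoped BigOperators Matrix Real ComplexConjugate
open Finset Matrix

namespace Literature.MathematicalPhysics.QuantumFieldTheory.Balaban1983to89.B5Prop12GLattice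

open Literature.MathematicalPhysics.QuantumFieldTheory.Balaban1983to89
open Literature.MathematicalPhysics.QuantumFieldTheory.Balaban1983to89.B5Prop11Plancherel (Tor fine)
open Literature.MathematicalPhysics.QuantumFieldTheory.Balaban1983to89.B5Prop12FieldsLattice (distU distU_nonneg)
open Literature.MathematicalPhysics.QuantumFieldTheory.Balaban1983to89.B5SettingP12Real (LocR latticeSettingP12R gP12R globCoverP12R
  modelSigns_latticeSettingP12R)
open Literature.MathematicalPhysics.QuantumFieldTheory.Balaban1983to89.B5Action121 (GradOp)
open Literature.MathematicalPhysics.QuantumFieldTheory.Balaban1983to89.B5Value126 (PcT)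
open Literature.MathematicalPhysics.QuantumFieldTheory.Balaban1983to89.B5SiteBridgeP12 (nP MP one_le_nP two_le_MP)
open Literature.MathematicalPhysics.QuantumFieldTheory.Balaban1983to89.B5Carrier132Pieces (latticeSettingP12Rt h1_Rt_of_le V kd kc
  carrier132 mapFacts pieceFacts uRow modelSigns_Rt)
open Literature.MathematicalPhysics.QuantumFieldTheory.Balaban1983to89.B5Display132Lattice (display132)
open Literature.MathematicalPhysics.QuantumFieldTheory.Balaban1983to89.B5G0DiagTorus (g0Diag famDiagTop)
open Literature.MathematicalPhysics.QuantumFieldTheory.Balaban1983to89.B5ResidualGpTorusHolds (TopIdx)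
open Literature.MathematicalPhysics.QuantumFieldTheory.Balaban1983to89.B5Transfer132 (KerBound)

noncomputable section

/-! ## §1 (1.126) entrywise for `∂·PcT·∂ᴴ` ⇒ `KerBound` for the kernel data of record -/

/-- **(1.126) ENTRYWISE FOR THE MATRIX OF RECORD ⇒ `KerBound (kd P) (d²·C) δ`**: the kernel of record is
`(∂P∂*)(x, x′) = η^{−d}·Σ_{μν}‖V_{(x,μ),(x′,ν)}‖` (the `η^d`-weighted kernel convention (1.120), indices summed), so an entry bound
`‖V_{(x,μ),(x′,ν)}‖ ≤ C·η^d·e^{−δ|x−x′|}` gives `|(∂P∂*)(x,x′)| ≤ d²C·e^{−δ|x−x′|}`.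
[cite: Balaban1984PropagatorsI, (1.126) p.38, (1.120) p.37] -/
theorem kerBound_kd_of_entries (P : Params) {C δ : ℝ}
    (H : ∀ i j : Tor (fine (nP P) (MP P)) × Fin P.d,
      ‖V (nP P) (MP P) i j‖ ≤ C * (((nP P : ℕ) : ℝ) ^ P.d)⁻¹ * Real.exp (-(δ * distU (nP P) (MP P) i.1 j.1))) :
    KerBound (kd P) ((P.d : ℝ) ^ 2 * C) δ := by
  intro x x'
  show |((nP P : ℝ) ^ P.d) * ∑ μ : Fin P.d, ∑ ν : Fin P.d, ‖V (nP P) (MP P) (x, μ) (x', ν)‖| ≤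
    (P.d : ℝ) ^ 2 * C * Real.exp (-(δ * distU (nP P) (MP P) x x'))
  have hn : (0 : ℝ) < (nP P : ℝ) ^ P.d := by
    have := one_le_nP P
    positivity
  rw [abs_of_nonneg (mul_nonneg hn.le (Finset.sum_nonneg fun _ _ => Finset.sum_nonneg fun _ _ => norm_nonneg _))]
  have hs : ∑ μ : Fin P.d, ∑ ν : Fin P.d, ‖V (nP P) (MP P) (x, μ) (x', ν)‖
      ≤ ∑ _μ : Fin P.d, ∑ _ν : Fin P.d, C * (((nP P : ℕ) : ℝ) ^ P.d)⁻¹ * Real.exp (-(δ * distU (nP P) (MP P) x x')) :=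
    Finset.sum_le_sum fun μ _ => Finset.sum_le_sum fun ν _ => H (x, μ) (x', ν)
  rw [Finset.sum_const, Finset.sum_const, Finset.card_univ, Fintype.card_fin, smul_smul, nsmul_eq_mul] at hs
  calc (nP P : ℝ) ^ P.d * ∑ μ : Fin P.d, ∑ ν : Fin P.d, ‖V (nP P) (MP P) (x, μ) (x', ν)‖
      ≤ (nP P : ℝ) ^ P.d * (((P.d * P.d : ℕ) : ℝ) * (C * (((nP P : ℕ) : ℝ) ^ P.d)⁻¹ *
          Real.exp (-(δ * distU (nP P) (MP P) x x')))) := mul_le_mul_of_nonneg_left hs hn.le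
    _ = (P.d : ℝ) ^ 2 * C * Real.exp (-(δ * distU (nP P) (MP P) x x')) := by
        have hn' : ((nP P : ℕ) : ℝ) ^ P.d ≠ 0 := hn.ne'
        field_simp
        push_cast
        ring

/-- `KerBound` is monotone in the constant. [cite: Balaban1984PropagatorsI, (1.126) p.38] -/
theorem kerBound_mono {Kd : B5.KernelData} {C C' δ : ℝ} (h : KerBound Kd C δ) (hC : C ≤ C') : KerBound Kd C' δ :=
  fun x x' => (h x x').trans (mul_le_mul_of_nonneg_right hC (Real.exp_nonneg _))

/-- **THE FAMILY-UNIFORM (1.126) FOR THE KERNEL DATA OF RECORD** over B5's top-level tori of dimension `d`, from (1.126)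
entrywise for `∂·PcT·∂ᴴ` with constants depending on `d` only («The constant O(1) in (1.126) depends on d only», p. 38) — the
hypothesis `H126` of `prop12_famG` in the shape r02's `prop12_of_G0_via132_of_kerBound` consumes.
[cite: Balaban1984PropagatorsI, (1.126) p.38] -/
theorem kerBound_fam_of_entries {d L : ℕ} {C δ : ℝ} (hδ : 0 < δ) (hC : 0 ≤ C)
    (H : ∀ (n : ℕ) [NeZero n] (M : Fin d → ℕ) [∀ μ, NeZero (M μ)] (i j : Tor (fine n M) × Fin d),
      ‖(GradOp (fine n M) (n : ℂ) * PcT n M (n : ℂ) * (GradOp (fine n M) (n : ℂ))ᴴ) i j‖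
        ≤ C * ((n : ℝ) ^ d)⁻¹ * Real.exp (-(δ * distU n M i.1 j.1))) :
    ∃ δ₀' C' : ℝ, 0 < δ₀' ∧ 0 < C' ∧ ∀ i : TopIdx d L, KerBound (kd i.P) C' δ₀' := by
  refine ⟨δ, (d : ℝ) ^ 2 * C + 1, hδ, by positivity, fun i => ?_⟩
  obtain ⟨P, hPd, hPL, hK⟩ := i
  subst hPd
  exact kerBound_mono (kerBound_kd_of_entries P fun i j => H (nP P) (MP P) i j) (le_add_of_nonneg_right zero_le_one)

/-! ## §2 The families of record and the located leaves of the (1.132)-transfer with family-uniform constants -/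

section Families

variable (d L : ℕ) (a : ℝ)

/-- **THE G-FAMILY OF RECORD over B5's top-level tori**: r02's real setting `latticeSettingP12R` (G = Δ_a⁻¹) at `n = L^K`,
`M = (2L^m, …, 2L^m)`, level `K`. [cite: Balaban1984PropagatorsI, Prop. 1.2 (1.108)–(1.114) pp.35–36, (1.71) p.30] -/
def famG : TopIdx d L → B5.Setting := fun i => latticeSettingP12R (nP i.P) (MP i.P) a i.P.K

/-- its h1-truncated copy (`B5Carrier132Pieces.latticeSettingP12Rt`). [cite: Balaban1984PropagatorsI, Prop. 1.2 (1.111) p.35] -/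
def famGt : TopIdx d L → B5.Setting := fun i => latticeSettingP12Rt (nP i.P) (MP i.P) a i.P.K

/-- unfolding of the family of record (definitional). [cite: Balaban1984PropagatorsI, Prop. 1.2 pp.35–36] -/
@[simp] theorem famG_apply (i : TopIdx d L) : famG d L a i = latticeSettingP12R (nP i.P) (MP i.P) a i.P.K := rfl

/-- unfolding of the truncated family (definitional). [cite: Balaban1984PropagatorsI, Prop. 1.2 (1.111) p.35] -/
@[simp] theorem famGt_apply (i : TopIdx d L) : famGt d L a i = latticeSettingP12Rt (nP i.P) (MP i.P) a i.P.K := rfl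

/-- **(1.114) for the family of record is (1.114) for the truncated copies** (the field `l2loc` is shared).
[cite: Balaban1984PropagatorsI, Prop. 1.2 (1.114) p.36] -/
theorem local114_famGt_of (h : B5.Local114Fam (famG d L a)) : B5.Local114Fam (famGt d L a) := by
  obtain ⟨δ₀, C, hδ, hC, H⟩ := h
  exact ⟨δ₀, C, hδ, hC, fun i => H i⟩

/-- **Proposition 1.2 for the family of record from Proposition 1.2 for the truncated copies**: (1.111) is read for `0 ≤ α < 1`
only («for 0 ≤ α < 1», p. 35). [cite: Balaban1984PropagatorsI, Prop. 1.2 (1.110)–(1.114) pp.35–36] -/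
theorem prop12_famG_of_famGt (h : B5.Prop12Printed (famGt d L a)) : B5.Prop12Printed (famG d L a) := by
  obtain ⟨δ₀, C, Cα, Cε, Cαε, hδ, hC, H⟩ := h
  refine ⟨δ₀, C, Cα, Cε, Cαε, hδ, hC, fun i => ⟨(H i).1, ?_, (H i).2.2.1, (H i).2.2.2.1, (H i).2.2.2.2⟩⟩
  intro α J ζ y y' h0 h1 hζ hJ
  have h := (H i).2.1 α J ζ y y' h0 h1 hζ hJ
  exact (h1_Rt_of_le (n := nP i.P) (M := MP i.P) (a := a) i.P.K J h1.le ζ).symm.trans_le h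

/-- **`MapFacts` for every member, r0 = 6, Nn = 13^d.** [cite: Balaban1984PropagatorsI, (1.132) p.39, (1.108)–(1.109) p.35] -/
theorem mapFacts_fam (i : TopIdx d L) :
    B5Transfer132.MapFacts (S' := famDiagTop d L a 0 i) (S₀ := famGt d L a i) (carrier132 i.P a) 6 ((13 : ℝ) ^ d) :=
  mapFacts i.P (by rw [i.hPd])

/-- **`PieceFacts132` for every member, A = √d, B = √(d³3^d), c₀ = 2.** [cite: Balaban1984PropagatorsI, (1.132) p.39, (1.114) p.36] -/
theorem pieceFacts_fam (i : TopIdx d L) :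
    B5Transfer132.PieceFacts132 (S' := famDiagTop d L a 0 i) (S₀ := famGt d L a i) (carrier132 i.P a) (kc i.P a i.P.K)
      (Real.sqrt d) (Real.sqrt ((d : ℝ) ^ 3 * 3 ^ d)) 2 :=
  pieceFacts i.P (by rw [i.hPd]) (by rw [i.hPd])

/-- **`Display133` for every member, Dh = d + 1** (a > 0). [cite: Balaban1984PropagatorsI, (1.132) p.39, (1.110)–(1.113) pp.35–36] -/
theorem display_fam {a : ℝ} (ha : 0 < a) (i : TopIdx d L) :
    B5Transfer133.Display133 (S' := famDiagTop d L a 0 i) (S₀ := famGt d L a i) (carrier132 i.P a) ((d : ℝ) + 1) :=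
  display132 i.P ha (by rw [i.hPd])

/-- **`URow` for every member with Λ(κ) = K_d(κ).** [cite: Balaban1984PropagatorsI, (1.132) p.39] -/
theorem uRow_fam : ∀ κ : ℝ, 0 < κ → ∃ Λ : ℝ, ∀ i : TopIdx d L,
    B5Transfer133.URow (S' := famDiagTop d L a 0 i) (S₀ := famGt d L a i) (carrier132 i.P a) κ Λ := by
  intro κ hκ
  refine ⟨B4Sect5Proof.latticeConst d κ, fun i => ?_⟩
  have e : B4Sect5Proof.latticeConst i.P.d κ = B4Sect5Proof.latticeConst d κ := by rw [i.hPd]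
  rw [← e]
  exact uRow i.P hκ

/-- the model signs of the diagonal G₀-family (p38 g5). [cite: Balaban1984PropagatorsI, (1.108)–(1.109) p.35] -/
theorem modelSigns_famDiagTop (i : TopIdx d L) : B5FromB4.ModelSigns (famDiagTop d L a 0 i) :=
  B5Prop12G0DiagTorus.modelSigns_g0Diag (P := i.P) a 0 i.P.K

/-- the model signs of the truncated G-family. [cite: Balaban1984PropagatorsI, (1.108)–(1.109) p.35] -/
theorem modelSigns_famGt (i : TopIdx d L) : B5FromB4.ModelSigns (famGt d L a i) :=
  modelSigns_Rt (nP i.P) (MP i.P) a i.P.K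

end Families

/-! ## §3 Proposition 1.2 for G on the torus: the (1.132) assembly -/

section Assembly

variable (d L : ℕ) (a : ℝ)

/-- **PROPOSITION 1.2 FOR THE TRUNCATED G-FAMILY** from Prop. 1.2 for G₀ (p38 g5 `prop12Printed_famDiagTop`, a theorem), the
family-uniform (1.126) for the kernel data of record (H126) and (1.114) for G (H114): r02's `prop12_of_G0_via132_of_kerBound` with
every located leaf discharged. [cite: Balaban1984PropagatorsI, (1.132) p.39] -/
theorem prop12_famGt (hd : 1 ≤ d) (hL : Odd L ∧ 1 < L) (ha : 0 < a)
    (H126 : ∃ δ₀' C : ℝ, 0 < δ₀' ∧ 0 < C ∧ ∀ i : TopIdx d L, KerBound (kd i.P) C δ₀')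
    (H114 : B5.Local114Fam (famGt d L a)) : B5.Prop12Printed (famGt d L a) :=
  B5Transfer132KerBound.prop12_of_G0_via132_of_kerBound (famDiagTop d L a 0) (famGt d L a) (fun i => carrier132 i.P a)
    (fun i => kd i.P) (fun i => kc i.P a i.P.K) (mapFacts_fam d L a) (pieceFacts_fam d L a) (display_fam d L ha)
    (modelSigns_famDiagTop d L a) (modelSigns_famGt d L a) (uRow_fam d L a)
    (B5Local114G0Torus.prop12Printed_famDiagTop d L hd hL ha) H126 H114

/-- **PROPOSITION 1.2 FOR BAŁABAN'S G = Δ_a⁻¹ ON EVERY TORUS OF THE FAMILY OF RECORD (`famG d L a`)**, every d ≥ 1, odd L > 1,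
a > 0, MODULO the family-uniform (1.126) for `∂·PcT·∂ᴴ` (H126) and (1.114) for G (H114) — «This together with the properties
(1.126) … of ∂P∂* and … (1.114) for the operator G implies immediately … Proposition 1.2 for G» with Proposition 1.2 for G₀ a
theorem and every located leaf of the (1.132)-transfer proved. [cite: Balaban1984PropagatorsI, Prop. 1.2 (1.110)–(1.114) pp.35–36, (1.132) p.39] -/
theorem prop12_famG (hd : 1 ≤ d) (hL : Odd L ∧ 1 < L) (ha : 0 < a)
    (H126 : ∃ δ₀' C : ℝ, 0 < δ₀' ∧ 0 < C ∧ ∀ i : TopIdx d L, KerBound (kd i.P) C δ₀')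
    (H114 : B5.Local114Fam (famG d L a)) : B5.Prop12Printed (famG d L a) :=
  prop12_famG_of_famGt d L a (prop12_famGt d L a hd hL ha H126 (local114_famGt_of d L a H114))

/-- **(H126) DISCHARGED: the family-uniform (1.126) for the kernel data of record over B5's top-level tori of dimension
`d ≥ 1`**, from p16's `B5PBridgeKernel126.norm_GradOp_PcT_GradOp_adjoint_le` ((1.126) for r02's typed `∂·PcT·∂ᴴ`, every `n ≥ 1`,
every torus of dimension `d′ + 1`, constants depending on the dimension only — b05's `B5DPD126Uniform` by B4's method).
[cite: Balaban1984PropagatorsI, (1.126) p.38 («The constant O(1) in (1.126) depends on d only»)] -/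
theorem kerBound_fam (hd : 1 ≤ d) :
    ∃ δ₀' C : ℝ, 0 < δ₀' ∧ 0 < C ∧ ∀ i : TopIdx d L, KerBound (kd i.P) C δ₀' := by
  obtain ⟨d', rfl⟩ : ∃ d', d = d' + 1 := ⟨d - 1, (Nat.sub_add_cancel hd).symm⟩
  obtain ⟨δ, C, hδ, hC, H⟩ := B5PBridgeKernel126.norm_GradOp_PcT_GradOp_adjoint_le d'
  exact kerBound_fam_of_entries hδ hC fun n _ M _ i j => H n M i j

/-- **PROPOSITION 1.2 FOR BAŁABAN'S G = Δ_a⁻¹ ON EVERY TORUS OF THE FAMILY OF RECORD, MODULO (1.114) FOR G ONLY** (every d ≥ 1,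
odd L > 1, a > 0): Proposition 1.2 for G₀ (p38 g5), (1.126) for `∂·PcT·∂ᴴ` (p16 g6 / b05), the identity (1.132) entrywise and
every located leaf of r02/b05's (1.132)-transfer are theorems; the one remaining printed input is (1.114) for G («(1.89), or (1.114)
for the operator G», p. 39). [cite: Balaban1984PropagatorsI, Prop. 1.2 (1.110)–(1.114) pp.35–36, (1.132) p.39, (1.126) p.38] -/
theorem prop12_famG_of_local114 (hd : 1 ≤ d) (hL : Odd L ∧ 1 < L) (ha : 0 < a)
    (H114 : B5.Local114Fam (famG d L a)) : B5.Prop12Printed (famG d L a) :=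
  prop12_famG d L a hd hL ha (kerBound_fam d L hd) H114

end Assembly

/-! ## §4 (1.115)–(1.117) for G on the torus (row B5.Eq1.117 for G, r02's cover of record) -/

section Global

variable (d L : ℕ) (a : ℝ)

/-- **p. 36 «(1.110)–(1.114) imply immediately (1.115)–(1.117)» FOR THE FAMILY OF RECORD**: `B5.Global115_117Fam (famG d L a)`
with r02's global Hölder data `gP12R` from `B5.Prop12Printed (famG d L a)`, by r02's cover `globCoverP12R` (every torus of the
family has `M_μ = 2L^m ≥ 2` unit cubes per direction) and `B5Global115.global_of_prop12`, constants uniform via `i.P.d = d`.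
[cite: Balaban1984PropagatorsI, (1.115)–(1.117) p.36] -/
theorem global115_117_famG :
    B5.Prop12Printed (famG d L a) →
      B5.Global115_117Fam (famG d L a) (fun i => gP12R (MP i.P) (nP i.P) a i.P.K) := by
  have h1 : (0 : ℝ) ≤ max 1 (B5CoverP12Lattice.Lw d) := le_max_of_le_left zero_le_one
  have h2 : (0 : ℝ) ≤ B5CoverP12Lattice.Lθ d + 1 := by
    have := B5CoverP12Lattice.Lθ_nonneg d
    positivity
  have cover : ∀ i : TopIdx d L, B5Global115.GlobCover (famG d L a i) (gP12R (MP i.P) (nP i.P) a i.P.K)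
      (max 1 (B5CoverP12Lattice.Lw d)) (B5CoverP12Lattice.Lθ d + 1) 8 := by
    intro i
    have e1 : B5CoverP12Lattice.Lw i.P.d = B5CoverP12Lattice.Lw d := by rw [i.hPd]
    have e2 : B5CoverP12Lattice.Lθ i.P.d = B5CoverP12Lattice.Lθ d := by rw [i.hPd]
    rw [← e1, ← e2]
    exact globCoverP12R (MP i.P) (nP i.P) a (two_le_MP i.P) i.P.K
  refine B5Global115.global_of_prop12 (famG d L a) (fun i => gP12R (MP i.P) (nP i.P) a i.P.K) h1 h2 cover
    (fun i => modelSigns_latticeSettingP12R (MP i.P) (nP i.P) a i.P.K) fun κ hκ => ?_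
  refine ⟨B4Sect5Proof.latticeConst d κ, fun i y => ?_⟩
  have e : B4Sect5Proof.latticeConst i.P.d κ = B4Sect5Proof.latticeConst d κ := by rw [i.hPd]
  rw [← e]
  exact B5TorusCover.rowSum_chart_le (B5RowSumsP12Lattice.chartP12 (MP i.P)) hκ _ y

/-- **(1.115)–(1.117) FOR G ON THE TORUS MODULO (1.114) FOR G ONLY** (rows B5.Eq1.115–1.117 for the operator G of record).
[cite: Balaban1984PropagatorsI, (1.115)–(1.117) p.36, (1.132) p.39] -/
theorem global115_117_famG_of_local114 (hd : 1 ≤ d) (hL : Odd L ∧ 1 < L) (ha : 0 < a)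
    (H114 : B5.Local114Fam (famG d L a)) :
    B5.Global115_117Fam (famG d L a) (fun i => gP12R (MP i.P) (nP i.P) a i.P.K) :=
  global115_117_famG d L a (prop12_famG_of_local114 d L a hd hL ha H114)

end Global

end

end Literature.MathematicalPhysics.QuantumFieldTheory.Balaban1983to89.B5Prop12GLattice
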